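import Mathlib
import Summits.NavierStokesRegularity.NavierStokesRegularity.Theorems.EulerZoomLiouvillePowerGaugeEulerLiouvilleSelfSimilarTopBadNodeArcDynamics
import HarnessLib.Audit

/-!
# Rung C1 of the crux `EulerZoomLiouville.PowerGaugeEulerLiouville`: TRAVEL ACROSS AN UNFORCED SLAB
# (inventory item (vi-c) of the no-exit lemma — the real-variable engine of CASE NT-arc)

Route №10 `EulerZoomLiouville` (NavierStokesRegularity), crux E = stmt-NavierStokesRegularity-19832,
tenure rung C1 (exactly self-similar members), registered residue `stub_selfSimilarExtremal`.
Twenty-third file of the NODAL-CONTINUUM line (lineage ns-typeII-p1, gen 7).  Elementary real analysis: for the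
UNFORCED tube inequalities `p' ≤ −μp + c(p+m)`, `m' ≥ μm − c(p+m)` (`c(1+K) ≤ μ/16`, `K ≥ 1`, `p, m ≥ 0`,
`p + m > 0`) on `[0, T]` and a drift `|σ'| ≤ ρ√(p+m)`, with `p + m ≤ S` throughout:

* `slab_travel_le` — `|σ(T) − σ(0)| ≤ 6ρ√((1+K)S)/μ`.
  Mechanism (no exponentials): before the first cone time `t_c` (`m < Kp`) one has `p > 0`, `p' ≤ −(15μ/16)p` and
  `|σ'| ≤ ρ√((1+K)p) = −(32ρ√(1+K)/(15μ)) (√p)'`-ish, so `±σ + (32ρ√(1+K)/(15μ))√p` is non-increasing; after `t_c` the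
  cone is kept (`cone_invariant_of_ineq`), `m > 0`, `m' ≥ (7μ/8)m`, `|σ'| ≤ ρ√(2m)`, so `±σ − (16√2ρ/(7μ))√m` is
  non-increasing; the two potentials bound the travel by `(32/15)ρ√((1+K)S)/μ + (16/7)ρ√(2S)/μ ≤ 6ρ√((1+K)S)/μ`.

WHAT THIS IS NOT: not NS, not E — elementary real analysis. [cite: KatokHasselblatt1995, §6.2 (cone criterion)]
-/

noncomputable section

-- flat `Theorems/<Route><Decl>…` files of one crux share the namespace of the crux (tree convention)
set_option linter.dupNamespace false

open Set Filter Topology Metric Function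

namespace Summit.NavierStokesRegularity.NavierStokesRegularity.Theorems.PowerGaugeEulerLiouville.NodalContinuum

/-- `|s| ≤ 1 ⇒ s·x ≤ |x|`. [folklore] -/
theorem mul_le_abs_of_abs_le_one {s x : ℝ} (hs : |s| ≤ 1) : s * x ≤ |x| := by
  calc s * x ≤ |s * x| := le_abs_self _
    _ = |s| * |x| := abs_mul _ _
    _ ≤ 1 * |x| := mul_le_mul_of_nonneg_right hs (abs_nonneg _)
    _ = |x| := one_mul _

/-- `|x| ≤ B` from the two one-sided bounds `s·x ≤ B`, `s = ±1`. [folklore] -/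
theorem abs_le_of_forall_sign {x B : ℝ} (h : ∀ s : ℝ, |s| ≤ 1 → s * x ≤ B) : |x| ≤ B := by
  have h1 := h 1 (by simp)
  have h2 := h (-1) (by simp)
  rw [abs_le]; constructor <;> linarith

set_option maxHeartbeats 400000 in
/-- **Travel across an unforced slab.**  See the module docstring. [cite: KatokHasselblatt1995, §6.2 (cone criterion)] -/
theorem slab_travel_le {p m σ pd md σd : ℝ → ℝ} {K μ c ρ S T : ℝ} (hK1 : 1 ≤ K) (hμ : 0 < μ) (hc0 : 0 ≤ c)
    (hcK : c * (1 + K) ≤ μ / 16) (hρ : 0 ≤ ρ) (hT : 0 ≤ T)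
    (hp' : ∀ t, HasDerivAt p (pd t) t) (hm' : ∀ t, HasDerivAt m (md t) t)
    (hσ' : ∀ t, HasDerivAt σ (σd t) t)
    (hpnn : ∀ t, 0 ≤ p t) (hmnn : ∀ t, 0 ≤ m t) (hpos : ∀ t ∈ Icc 0 T, 0 < p t + m t)
    (hpd : ∀ t ∈ Icc 0 T, pd t ≤ -μ * p t + c * (p t + m t))
    (hmd : ∀ t ∈ Icc 0 T, μ * m t - c * (p t + m t) ≤ md t)
    (hσd : ∀ t ∈ Icc 0 T, |σd t| ≤ ρ * Real.sqrt (p t + m t))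
    (hsup : ∀ t ∈ Icc 0 T, p t + m t ≤ S) :
    |σ T - σ 0| ≤ 6 * ρ * Real.sqrt ((1 + K) * S) / μ := by
  have hKpos : 0 < K := by linarith
  have hc32 : c ≤ μ / 32 := by nlinarith
  have hsqS : ∀ t ∈ Icc 0 T, Real.sqrt (p t) ≤ Real.sqrt S ∧ Real.sqrt (m t) ≤ Real.sqrt S := fun t ht =>
    ⟨Real.sqrt_le_sqrt (by linarith [hsup t ht, hmnn t]), Real.sqrt_le_sqrt (by linarith [hsup t ht, hpnn t])⟩
  set k₁ : ℝ := 15 * μ / 16 with hk₁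
  set k₂ : ℝ := 7 * μ / 8 with hk₂
  have hk₁pos : 0 < k₁ := by positivity
  have hk₂pos : 0 < k₂ := by positivity
  set a₁ : ℝ := 2 * ρ * Real.sqrt (1 + K) / k₁ with ha₁
  set a₂ : ℝ := 2 * Real.sqrt 2 * ρ / k₂ with ha₂
  have ha₁nn : 0 ≤ a₁ := by positivity
  have ha₂nn : 0 ≤ a₂ := by positivity
  have ha₁k : a₁ * k₁ = 2 * ρ * Real.sqrt (1 + K) := by rw [ha₁]; field_simp
  have ha₂k : a₂ * k₂ = 2 * Real.sqrt 2 * ρ := by rw [ha₂]; field_simp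
  /- PHASE 1 (decay): no cone on `(t0, t')` ⇒ travel `≤ a₁ √S` -/
  have decay : ∀ t0 t', 0 ≤ t0 → t0 ≤ t' → t' ≤ T → (∀ t ∈ Ioo t0 t', m t < K * p t) →
      |σ t' - σ t0| ≤ a₁ * Real.sqrt S := by
    intro t0 t' h0 h0' h'T hnc
    have hsub : Icc t0 t' ⊆ Icc 0 T := Icc_subset_Icc h0 h'T
    have hpt : ∀ t ∈ Ioo t0 t', 0 < p t := by
      intro t ht
      have h1 := hpos t (hsub (Ioo_subset_Icc_self ht))
      have h2 := hnc t ht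
      have h3 := hmnn t
      nlinarith
    refine abs_le_of_forall_sign fun s hs => ?_
    have hderiv : ∀ t ∈ Ioo t0 t', HasDerivAt (fun t => s * σ t + a₁ * Real.sqrt (p t))
        (s * σd t + a₁ * (pd t / (2 * Real.sqrt (p t)))) t := fun t ht =>
      ((hσ' t).const_mul s).add (((hp' t).sqrt (hpt t ht).ne').const_mul a₁)
    have hanti : AntitoneOn (fun t => s * σ t + a₁ * Real.sqrt (p t)) (Icc t0 t') := by
      refine antitoneOn_of_deriv_nonpos (convex_Icc _ _) ?_ ?_ ?_
      · exact fun t _ => (((hσ' t).continuousAt.const_mul s).add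
          ((hp' t).continuousAt.sqrt.const_mul a₁)).continuousWithinAt
      · intro t ht
        rw [interior_Icc] at ht
        exact (hderiv t ht).differentiableAt.differentiableWithinAt
      · intro t ht
        rw [interior_Icc] at ht
        rw [(hderiv t ht).deriv]
        have htT := hsub (Ioo_subset_Icc_self ht)
        have hp0 := hpt t ht
        have hsq : 0 < Real.sqrt (p t) := Real.sqrt_pos.2 hp0
        have h1 : s * σd t ≤ ρ * Real.sqrt (p t + m t) :=
          (mul_le_abs_of_abs_le_one hs).trans (hσd t htT)
        have h2 : Real.sqrt (p t + m t) ≤ Real.sqrt (1 + K) * Real.sqrt (p t) := by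
          rw [← Real.sqrt_mul (by linarith)]
          exact Real.sqrt_le_sqrt (by nlinarith [hnc t ht])
        have h3 : pd t ≤ -k₁ * p t := by
          have h4 := hpd t htT
          have h5 : c * (p t + m t) ≤ c * ((1 + K) * p t) :=
            mul_le_mul_of_nonneg_left (by nlinarith [hnc t ht]) hc0
          have h6 : c * ((1 + K) * p t) = c * (1 + K) * p t := by ring
          have h7 : c * (1 + K) * p t ≤ μ / 16 * p t := mul_le_mul_of_nonneg_right hcK (hpnn t)
          rw [hk₁]; linarith
        have h4 : pd t / (2 * Real.sqrt (p t)) ≤ -k₁ * p t / (2 * Real.sqrt (p t)) :=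
          div_le_div_of_nonneg_right h3 (by positivity)
        have h5 : -k₁ * p t / (2 * Real.sqrt (p t)) = -(k₁ / 2) * Real.sqrt (p t) := by
          rw [show -k₁ * p t / (2 * Real.sqrt (p t)) = -(k₁ / 2) * (p t / Real.sqrt (p t)) by ring,
            Real.div_sqrt]
        have h6 : a₁ * (pd t / (2 * Real.sqrt (p t))) ≤ a₁ * (-(k₁ / 2) * Real.sqrt (p t)) :=
          mul_le_mul_of_nonneg_left (h4.trans_eq h5) ha₁nn
        have h7 : a₁ * (-(k₁ / 2) * Real.sqrt (p t)) = -(ρ * Real.sqrt (1 + K)) * Real.sqrt (p t) := by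
          have : a₁ * (-(k₁ / 2) * Real.sqrt (p t)) = -(a₁ * k₁) / 2 * Real.sqrt (p t) := by ring
          rw [this, ha₁k]; ring
        have h8 : ρ * Real.sqrt (p t + m t) ≤ ρ * (Real.sqrt (1 + K) * Real.sqrt (p t)) :=
          mul_le_mul_of_nonneg_left h2 hρ
        linarith
    have hmono := hanti (left_mem_Icc.2 h0') (right_mem_Icc.2 h0') h0'
    simp only at hmono
    have hS1 := (hsqS t0 ⟨h0, h0'.trans h'T⟩).1
    have hp1 : 0 ≤ a₁ * Real.sqrt (p t') := by positivity
    have hp2 : a₁ * Real.sqrt (p t0) ≤ a₁ * Real.sqrt S := mul_le_mul_of_nonneg_left hS1 ha₁nn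
    linarith
  /- PHASE 2 (growth): cone on `[t0, t']` ⇒ travel `≤ a₂ √S` -/
  have growth : ∀ t0 t', 0 ≤ t0 → t0 ≤ t' → t' ≤ T → (∀ t ∈ Icc t0 t', K * p t ≤ m t) →
      |σ t' - σ t0| ≤ a₂ * Real.sqrt S := by
    intro t0 t' h0 h0' h'T hc
    have hsub : Icc t0 t' ⊆ Icc 0 T := Icc_subset_Icc h0 h'T
    have hmt : ∀ t ∈ Icc t0 t', 0 < m t := by
      intro t ht
      have h1 := hpos t (hsub ht)
      have h2 := hc t ht
      have h3 := hpnn t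
      nlinarith
    refine abs_le_of_forall_sign fun s hs => ?_
    have hderiv : ∀ t ∈ Icc t0 t', HasDerivAt (fun t => s * σ t - a₂ * Real.sqrt (m t))
        (s * σd t - a₂ * (md t / (2 * Real.sqrt (m t)))) t := fun t ht =>
      ((hσ' t).const_mul s).sub (((hm' t).sqrt (hmt t ht).ne').const_mul a₂)
    have hanti : AntitoneOn (fun t => s * σ t - a₂ * Real.sqrt (m t)) (Icc t0 t') := by
      refine antitoneOn_of_deriv_nonpos (convex_Icc _ _) ?_ ?_ ?_
      · exact fun t ht => (hderiv t ht).continuousAt.continuousWithinAt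
      · intro t ht
        exact (hderiv t (interior_subset ht)).differentiableAt.differentiableWithinAt
      · intro t ht
        rw [interior_Icc] at ht
        have ht' : t ∈ Icc t0 t' := Ioo_subset_Icc_self ht
        rw [(hderiv t ht').deriv]
        have htT := hsub ht'
        have hm0 := hmt t ht'
        have hsq : 0 < Real.sqrt (m t) := Real.sqrt_pos.2 hm0
        have hct := hc t ht'
        have h1 : s * σd t ≤ ρ * Real.sqrt (p t + m t) :=
          (mul_le_abs_of_abs_le_one hs).trans (hσd t htT)
        have hpm : p t ≤ m t := by nlinarith [hpnn t]
        have h2 : Real.sqrt (p t + m t) ≤ Real.sqrt 2 * Real.sqrt (m t) := by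
          rw [← Real.sqrt_mul (by norm_num)]
          exact Real.sqrt_le_sqrt (by linarith)
        have h3 : k₂ * m t ≤ md t := by
          have h4 := hmd t htT
          have h5 : c * (p t + m t) ≤ μ / 32 * (2 * m t) := by
            calc c * (p t + m t) ≤ c * (2 * m t) := mul_le_mul_of_nonneg_left (by linarith) hc0
              _ ≤ μ / 32 * (2 * m t) := mul_le_mul_of_nonneg_right hc32 (by linarith)
          have h6 : 0 ≤ μ * m t := by positivity
          rw [hk₂]; linarith
        have h4 : k₂ * m t / (2 * Real.sqrt (m t)) ≤ md t / (2 * Real.sqrt (m t)) :=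
          div_le_div_of_nonneg_right h3 (by positivity)
        have h5 : k₂ * m t / (2 * Real.sqrt (m t)) = k₂ / 2 * Real.sqrt (m t) := by
          rw [show k₂ * m t / (2 * Real.sqrt (m t)) = k₂ / 2 * (m t / Real.sqrt (m t)) by ring,
            Real.div_sqrt]
        have h6 : a₂ * (k₂ / 2 * Real.sqrt (m t)) ≤ a₂ * (md t / (2 * Real.sqrt (m t))) :=
          mul_le_mul_of_nonneg_left (h5.symm.trans_le h4) ha₂nn
        have h7 : a₂ * (k₂ / 2 * Real.sqrt (m t)) = Real.sqrt 2 * ρ * Real.sqrt (m t) := by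
          have : a₂ * (k₂ / 2 * Real.sqrt (m t)) = (a₂ * k₂) / 2 * Real.sqrt (m t) := by ring
          rw [this, ha₂k]; ring
        have h8 : ρ * Real.sqrt (p t + m t) ≤ ρ * (Real.sqrt 2 * Real.sqrt (m t)) :=
          mul_le_mul_of_nonneg_left h2 hρ
        linarith
    have hmono := hanti (left_mem_Icc.2 h0') (right_mem_Icc.2 h0') h0'
    simp only at hmono
    have hS1 := (hsqS t' ⟨h0.trans h0', h'T⟩).2
    have hp1 : 0 ≤ a₂ * Real.sqrt (m t0) := by positivity
    have hp2 : a₂ * Real.sqrt (m t') ≤ a₂ * Real.sqrt S := mul_le_mul_of_nonneg_left hS1 ha₂nn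
    linarith
  /- the numerical bound `a₁ √S + a₂ √S ≤ 6ρ√((1+K)S)/μ` -/
  have hnum : a₁ * Real.sqrt S + a₂ * Real.sqrt S ≤ 6 * ρ * Real.sqrt ((1 + K) * S) / μ := by
    have hK2 : Real.sqrt 2 ≤ Real.sqrt (1 + K) := Real.sqrt_le_sqrt (by linarith)
    rw [Real.sqrt_mul (by linarith)]
    have e1 : a₁ * Real.sqrt S = 32 / 15 * (ρ * Real.sqrt (1 + K) * Real.sqrt S / μ) := by
      rw [ha₁, hk₁]; field_simp; ring
    have e2 : a₂ * Real.sqrt S = 16 / 7 * (ρ * Real.sqrt 2 * Real.sqrt S / μ) := by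
      rw [ha₂, hk₂]; field_simp; ring
    have h3 : ρ * Real.sqrt 2 * Real.sqrt S / μ ≤ ρ * Real.sqrt (1 + K) * Real.sqrt S / μ := by
      apply div_le_div_of_nonneg_right _ hμ.le
      exact mul_le_mul_of_nonneg_right (mul_le_mul_of_nonneg_left hK2 hρ) (Real.sqrt_nonneg _)
    have h4 : 0 ≤ ρ * Real.sqrt (1 + K) * Real.sqrt S / μ := by positivity
    rw [e1, e2]
    have : 6 * ρ * (Real.sqrt (1 + K) * Real.sqrt S) / μ = 6 * (ρ * Real.sqrt (1 + K) * Real.sqrt S / μ) := by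
      ring
    rw [this]
    linarith
  /- the first cone time -/
  set Cn : Set ℝ := {t | t ∈ Icc 0 T ∧ K * p t ≤ m t} with hCn
  by_cases hne : Cn.Nonempty
  · have hbdd : BddBelow Cn := ⟨0, fun t ht => ht.1.1⟩
    have hclosed : IsClosed Cn := by
      have hcont : ContinuousOn (fun t => m t - K * p t) (Icc 0 T) := fun t _ =>
        ((hm' t).sub ((hp' t).const_mul K)).continuousAt.continuousWithinAt
      have : Cn = Icc 0 T ∩ (fun t => m t - K * p t) ⁻¹' Ici 0 := by
        ext t
        simp only [hCn, mem_setOf_eq, mem_inter_iff, mem_preimage, mem_Ici, sub_nonneg]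
      rw [this]
      exact hcont.preimage_isClosed_of_isClosed isClosed_Icc isClosed_Ici
    set tc := sInf Cn with htc
    have htcC : tc ∈ Cn := hclosed.csInf_mem hne hbdd
    have htc0 : 0 ≤ tc := htcC.1.1
    have htcT : tc ≤ T := htcC.1.2
    have hbefore : ∀ t ∈ Ioo 0 tc, m t < K * p t := by
      intro t ht
      by_contra hge
      push Not at hge
      have htC : t ∈ Cn := ⟨⟨ht.1.le, ht.2.le.trans htcT⟩, hge⟩
      exact absurd (csInf_le hbdd htC) (not_le.2 ht.2)
    -- the cone is kept on `[tc, T]` (shifted `cone_invariant_of_ineq`)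
    have hafter : ∀ t ∈ Icc tc T, K * p t ≤ m t := by
      intro t ht
      have hps : ∀ s, HasDerivAt (fun s => p (tc + s)) (pd (tc + s)) s := fun s =>
        (hp' (tc + s)).comp_const_add tc s
      have hms : ∀ s, HasDerivAt (fun s => m (tc + s)) (md (tc + s)) s := fun s =>
        (hm' (tc + s)).comp_const_add tc s
      have hshift : ∀ s ∈ Icc 0 (t - tc), tc + s ∈ Icc 0 T := fun s hs =>
        ⟨by linarith [hs.1], by linarith [hs.2, ht.2]⟩
      have := cone_invariant_of_ineq (p := fun s => p (tc + s)) (m := fun s => m (tc + s)) (K := K)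
        hK1 hμ hcK hps hms (fun s hs => hpos _ (hshift s hs)) (fun s hs => hpd _ (hshift s hs))
        (fun s hs => hmd _ (hshift s hs)) (tc := 0) ⟨le_rfl, by linarith [ht.1]⟩
        (by simpa only [add_zero] using htcC.2)
      simpa only [add_sub_cancel] using this
    have h1 := decay 0 tc le_rfl htc0 htcT hbefore
    have h2 := growth tc T htc0 htcT le_rfl hafter
    calc |σ T - σ 0| = |(σ T - σ tc) + (σ tc - σ 0)| := by ring_nf
      _ ≤ |σ T - σ tc| + |σ tc - σ 0| := abs_add_le _ _
      _ ≤ a₂ * Real.sqrt S + a₁ * Real.sqrt S := add_le_add h2 h1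
      _ ≤ 6 * ρ * Real.sqrt ((1 + K) * S) / μ := by linarith
  · -- never in the cone
    have hnc : ∀ t ∈ Ioo 0 T, m t < K * p t := by
      intro t ht
      by_contra hge
      push Not at hge
      exact hne ⟨t, ⟨ht.1.le, ht.2.le⟩, hge⟩
    have h1 := decay 0 T le_rfl hT le_rfl hnc
    have h2 : 0 ≤ a₂ * Real.sqrt S := by positivity
    linarith

end Summit.NavierStokesRegularity.NavierStokesRegularity.Theorems.PowerGaugeEulerLiouville.NodalContinuum
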